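import Literature.NumberTheory.Automorphic.ArthurClozelFibresProofs
import HarnessLib

/-!
# Arthur–Clozel, Ch. 3, Thm. 3.1 from the continuation of `L^S(s, π × σ)` for `π ≇ σ̃` alone
# (cyclic positivity and Landau's lemma; proofs only)

Topic `NumberTheory/Automorphic`; namespace `Literature.NumberTheory.Automorphic`. Proof file
(theorems only: no definition, no named fact, no instance), sibling of `ArthurClozelFibresProofs`
under the named fact `ArthurClozel1989_fibres_of_baseChange` of `ArthurClozelBaseChange` —
J. Arthur, L. Clozel, *Simple algebras, base change, and the advanced theory of the trace formula*,
Ann. of Math. Stud. 120 (1989), Ch. 3, **Thm. 3.1** (held scan chunk 172; printed volume p. 201):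
for `E/F` cyclic and `π`, `π'` cuspidal on `GL_n(𝔸_F)` with `(t_{π,v})^{f_v} = (t_{π',v})^{f_v}`
for almost all `v`, `π' ≅ π ⊗ χ` for a character `χ` of `F^* N(𝔸_E^*) \ 𝔸^*`.

`ArthurClozelFibresProofs` formalises the printed proof: the Euler identity
`∏_{i<l} L^S(s, π ⊗ π̃' ⊗ ηⁱ) = ∏_{i<l} L^S(s, π ⊗ π̃ ⊗ ηⁱ)` (`Re s > 1`) and a *pole count* at
`s = 1` resting on Jacquet–Shalika (2.2) (finite non-zero limit for `π ≇ σ̃`) and (2.3) (simple pole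
for `π ≅ σ̃`), i.e. — through `PairLFunctionPolesRankNeLandau`, `PairLFunctionPolesEqConjLandau` —
on **both** continuation statements of Mœglin–Waldspurger (1989), Appendice, Corollaire: (i)(b) for
`π ≇ σ̃` and (ii) for `π ≅ σ̃` (`arthurClozel1989_fibres_of_baseChange_of_moeglinWaldspurger`).

This file removes Corollaire (ii), (2.3) and the non-vanishing on `Re s = 1` from the
requirements: **Thm. 3.1 follows from the holomorphy of `L^S(s, π × σ)`, `π ≇ σ̃`, on one right
half-plane `{Re s > A}` with `A < 0`** (`arthurClozel1989_fibres_of_baseChange_of_ne_conj_halfPlane`),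
in particular from `MoeglinWaldspurger1989_partialPairL_entire_of_ne_conj` alone
(`arthurClozel1989_fibres_of_baseChange_of_entire_of_ne_conj`). The observation (a variant of the
positivity argument of Jacquet–Shalika, *Euler products I*, proof of Thm. (5.3), p. 556, not in
Arthur–Clozel's text): the right-hand side of the Euler identity is, place by place,
`∏_{i<l} det(1 - t_v ⊗ t̄_v ζ_vⁱ q_v^{-s})⁻¹ = det(1 - t_v^{f_v} ⊗ t̄_v^{f_v} q_v^{-f_v s})^{-l/f_v}`
(`ζ_v` a primitive `f_v`-th root of unity; `prod_range_eval_satakePairPolynomial_map_mul` of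
`PairLFunctionBaseChange`), whose logarithm `∑_{f_v ∣ k} l |tr t_v^k|² q_v^{-ks} / k` has
**non-negative** coefficients — only the exponents divisible by `f_v` survive the sum over the `l`
twists. Hence `∏_{i<l} L^S(s, π ⊗ π̃ ⊗ ηⁱ) = exp (∑_m b_m m^{-s})` with `b ≥ 0`
(`prod_partialPairL_twists_conj_eq_exp_LSeries`). If no `i` had `π' ≅ π ⊗ ηⁱ`, the left-hand side
— a product of `l` functions `L^S(s, π' × σᵢ)` with `π' ≇ σ̃ᵢ` — would be holomorphic on
`{Re s > A}`, so by Landau's lemma (Montgomery–Vaughan Thm. 1.7;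
`Literature.NumberTheory.LFunctions.Landau.abscissaOfAbsConv_le_of_exp_eq`) the series of `b` would
converge at some `σ < 0`; at a **single** unramified place `v₀` this says
`l |tr t_{v₀}^m|² q_{v₀}^{m|σ|} / m → 0` along `f_{v₀} ∣ m`, which is absurd because
`|det t_{v₀}| = |ω_π(ϖ_{v₀})| = 1` forces `|tr t_{v₀}^{f_{v₀} j k}| ≥ 2^{-(n+1)}` for some `k ≤ n`,
for every `j` (`exists_norm_powerSum_ge_of_norm_prod_eq_one` of `PairLFunctionPolesRankNeLandau`)
(`false_of_differentiableOn_eq_cexp_LSeries_fiberCoeff`). No input at the pair `π ≅ σ̃`, none on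
the line `Re s = 1`, and no density statement on the split places is used.

Contents (all proved):

* `hasSum_ite_dvd_normSq_powerSum_mul_pow_div`, `cexp_natCast_mul_neg_sum_log_eq` — the local
  series `∑_{f ∣ k} l |p_k(α)|² x^k / k = g · log det(1 - A^f ⊗ Ā^f x^f)⁻¹` (`f g = l`) and its
  exponential;
* `prod_partialPairL_twists_conj_eq_exp_LSeries` — `∏_{i<l} L^S(s, α ⊗ ξⁱ ᾱ) = exp (LSeries b s)`
  on `Re s > 2`, `b = fiberCoeff c (q_v^{k+1}) ≥ 0` (the regrouping of `JacquetShalikaEulerProducts`);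
* `false_of_differentiableOn_eq_cexp_LSeries_fiberCoeff` — the contradiction at one place;
* `exists_eq_conj_of_prod_partialPairL_eq_cexp_LSeries` — the pole count of the printed proof,
  replaced: continuation for the pairs `π' ≇ σ̃ᵢ` suffices;
* `arthurClozel1989_fibres_of_baseChange_of_ne_conj_halfPlane` — **Thm. 3.1 from the right-half-plane
  part (`A < 0`) of Corollaire (i)(b) alone** (set-up as in
  `arthurClozel1989_fibres_of_baseChange_of_jacquetShalika`: `exists_isClassFieldCharacter_holds`,
  `IsClassFieldCharacter.eventually_isPrimitiveRoot_valueAtUniformizer_of_isCyclic`,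
  `prod_partialPairL_twists_eq_of_map_pow_eq`, `JacquetShalika1981_multipliable_partialPairL_holds`);
* `arthurClozel1989_fibres_of_baseChange_of_entire_of_ne_conj` — **Thm. 3.1 from
  `MoeglinWaldspurger1989_partialPairL_entire_of_ne_conj` alone.**

What is *not* done here: `ArthurClozel1989_fibres_of_baseChange_holds` itself — it is
`arthurClozel1989_fibres_of_baseChange_of_entire_of_ne_conj h₁` once Corollaire (i)(b)
(`MoeglinWaldspurger1989_partialPairL_entire_of_ne_conj`, the Rankin–Selberg theory on
`GL(n) × GL(n)` for `π ≇ σ̃`), held as a named fact, is a theorem.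

## References

* J. Arthur, L. Clozel, *Simple algebras, base change, and the advanced theory of the trace
  formula*, Ann. of Math. Stud. 120 (1989), Ch. 3, §2 (2.1)–(2.3), Thm. 3.1 and its proof
  (held scan chunks 171–172; printed volume pp. 200–201). [ArthurClozelAMS120]
* C. Mœglin, J.-L. Waldspurger, *Le spectre résiduel de `GL(n)`*, Ann. Sci. ÉNS (4) 22 (1989),
  Appendice, Corollaire (i)(b), p. 667. [MoeglinWaldspurger1989]
* H. Jacquet, J. A. Shalika, *On Euler products and the classification of automorphic
  representations I*, Amer. J. Math. 103 (1981), Thm. (5.3) and its proof, p. 556.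
  [JacquetShalikaAJM1981]
* H. L. Montgomery, R. C. Vaughan, *Multiplicative Number Theory I*, CUP (2007), §1.2, Thm. 1.7
  (Landau). [MontgomeryVaughan2007]
-/

noncomputable section

open scoped MatrixGroups Topology ComplexConjugate
open NumberField IsDedekindDomain MeasureTheory Filter Complex

namespace Literature.NumberTheory.Automorphic

open AdelicGroupData
open Literature.NumberTheory.GaloisRepresentations (HeckeCharacter)

/-! ### The local series: only the exponents divisible by `f` survive the sum over the twists -/

section Local

/-- **The logarithm of `det(1 - A^f ⊗ Ā^f x^f)^{-g}` as a series in `x`.** For a multiset `α`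
with `‖a‖ ≤ R` (`a ∈ α`), `R² ‖x‖ < 1`, `f ≥ 1` and `f g = l`:
`∑_{k ≥ 1, f ∣ k} l |p_k(α)|² x^k / k = g · (-∑_{c ∈ α^f ⊗ \overline{α^f}} log (1 - c x^f))`
(the series `hasSum_normSq_powerSum_mul_pow_div` of `α^f = {a^f}` at `x^f`, reindexed by
`k = f j`: `p_j(α^f) = p_{fj}(α)`, `g / j = l / (f j)`). Indexed by `k : ℕ` for the exponent
`k + 1`. [folklore] -/
theorem hasSum_ite_dvd_normSq_powerSum_mul_pow_div {α : Multiset ℂ} {R : ℝ} (hR : 0 ≤ R)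
    (hα : ∀ a ∈ α, ‖a‖ ≤ R) {x : ℂ} (hx : R * R * ‖x‖ < 1) {f : ℕ} (hf : 0 < f) (g l : ℕ)
    (hfg : f * g = l) :
    HasSum (fun k : ℕ => if f ∣ k + 1 then
        (l : ℂ) * (((‖(α.map (· ^ (k + 1))).sum‖ ^ 2 : ℝ) : ℂ) * x ^ (k + 1) / (k + 1)) else 0)
      ((g : ℂ) * -((satakeTensor (α.map (· ^ f)) ((α.map (· ^ f)).map conj)).map
        fun c => Complex.log (1 - c * x ^ f)).sum) := by
  -- the series of `α^f` at `x^f`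
  have hαf : ∀ a ∈ α.map (· ^ f), ‖a‖ ≤ R ^ f := by
    intro a ha
    obtain ⟨b, hb, rfl⟩ := Multiset.mem_map.mp ha
    rw [norm_pow]
    exact pow_le_pow_left₀ (norm_nonneg b) (hα b hb) f
  have hxf : R ^ f * R ^ f * ‖x ^ f‖ < 1 := by
    rw [norm_pow, ← mul_pow, ← mul_pow]
    exact pow_lt_one₀ (by positivity) hx hf.ne'
  have h := (hasSum_normSq_powerSum_mul_pow_div hαf hxf).mul_left (g : ℂ)
  -- reindex along `j ↦ f (j + 1) - 1`
  set e : ℕ → ℕ := fun j => f * (j + 1) - 1 with he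
  have he1 : ∀ j, e j + 1 = f * (j + 1) := fun j =>
    Nat.sub_add_cancel (Nat.one_le_iff_ne_zero.mpr (Nat.mul_ne_zero hf.ne' (Nat.succ_ne_zero j)))
  have heinj : Function.Injective e := by
    intro j j' hjj'
    have h1 : f * (j + 1) = f * (j' + 1) := by rw [← he1, ← he1, hjj']
    exact Nat.succ_injective (Nat.eq_of_mul_eq_mul_left hf h1)
  have hoff : ∀ k ∉ Set.range e, (fun k : ℕ => if f ∣ k + 1 then
      (l : ℂ) * (((‖(α.map (· ^ (k + 1))).sum‖ ^ 2 : ℝ) : ℂ) * x ^ (k + 1) / (k + 1)) else 0) k = 0 := by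
    intro k hk
    simp only
    rw [if_neg]
    rintro ⟨q, hq⟩
    refine hk ⟨q - 1, ?_⟩
    have hq1 : 1 ≤ q := Nat.one_le_iff_ne_zero.mpr (by rintro rfl; simp at hq)
    show f * (q - 1 + 1) - 1 = k
    rw [Nat.sub_add_cancel hq1, ← hq, Nat.add_sub_cancel]
  refine (heinj.hasSum_iff hoff).mp (h.congr_fun fun j => ?_)
  simp only [Function.comp_apply]
  rw [if_pos ⟨j + 1, (he1 j)⟩]
  have hcast : ((e j : ℂ) + 1) = (f : ℂ) * ((j : ℂ) + 1) := by
    have : ((e j + 1 : ℕ) : ℂ) = ((f * (j + 1) : ℕ) : ℂ) := by rw [he1]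
    push_cast at this
    exact this
  have hpow : (α.map (· ^ (e j + 1))) = ((α.map (· ^ f)).map (· ^ (j + 1))) := by
    rw [he1, Multiset.map_map]
    exact Multiset.map_congr rfl fun a _ => by simp only [Function.comp_apply, pow_mul]
  have hxpow : x ^ (e j + 1) = (x ^ f) ^ (j + 1) := by rw [he1, pow_mul]
  rw [hpow, hxpow, hcast, ← hfg]
  have hf0 : (f : ℂ) ≠ 0 := by exact_mod_cast hf.ne'
  have hj0 : ((j : ℂ) + 1) ≠ 0 := by exact_mod_cast Nat.succ_ne_zero j
  push_cast
  field_simp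

/-- **Exponential form.** Under the same hypotheses on `α`, `x`, `f`:
`exp (g · (-∑_{c ∈ α^f ⊗ \overline{α^f}} log (1 - c x^f))) = (det(1 - A^f ⊗ Ā^f x^f)⁻¹)^g`.
[folklore] -/
theorem cexp_natCast_mul_neg_sum_log_eq {α : Multiset ℂ} {R : ℝ} (hR : 0 ≤ R)
    (hα : ∀ a ∈ α, ‖a‖ ≤ R) {x : ℂ} (hx : R * R * ‖x‖ < 1) {f : ℕ} (hf : 0 < f) (g : ℕ) :
    cexp ((g : ℂ) * -((satakeTensor (α.map (· ^ f)) ((α.map (· ^ f)).map conj)).map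
        fun c => Complex.log (1 - c * x ^ f)).sum) =
      (((satakePairPolynomial (α.map (· ^ f)) ((α.map (· ^ f)).map conj)).eval (x ^ f)) ^ g)⁻¹ := by
  have hαf : ∀ a ∈ α.map (· ^ f), ‖a‖ ≤ R ^ f := by
    intro a ha
    obtain ⟨b, hb, rfl⟩ := Multiset.mem_map.mp ha
    rw [norm_pow]
    exact pow_le_pow_left₀ (norm_nonneg b) (hα b hb) f
  have hxf : R ^ f * R ^ f * ‖x ^ f‖ < 1 := by
    rw [norm_pow, ← mul_pow, ← mul_pow]
    exact pow_lt_one₀ (by positivity) hx hf.ne'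
  rw [Complex.exp_nat_mul, exp_neg_sum_log_eq_inv_eval_satakePairPolynomial_conj hαf hxf, inv_pow]

end Local

/-! ### The global identity: `∏_{i<l} L^S(s, α ⊗ ξⁱ ᾱ)` is the exponential of a Dirichlet series
with non-negative coefficients -/

section Global

variable {K : Type} [Field K] [NumberField K]

/-- **`∏_{i<l} L^S(s, α ⊗ ξⁱ ᾱ) = exp (∑_m b_m m^{-s})` with `b ≥ 0`, `Re s > 2`.** Let `α` be a
Satake family with the local bound `|a| ≤ q_v^{1/2}` and `≤ n` entries off `S`; off `S` let
`f_v g_v = l ≥ 1` and `ξ_v` be a primitive `f_v`-th root of unity. If the `l` partial Euler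
products `L^S(s, α ⊗ ξ_vⁱ ᾱ)` (`i < l`) converge at `s`, `Re s > 2`, then their product is
`exp (LSeries b s)` for the regrouped series `b = fiberCoeff c (q_v^{k+1})` of the family
`c_{(k,v)} = l |p_{k+1}(α_v)|² / (k+1)` if `f_v ∣ k + 1` and `0` otherwise — a Dirichlet series
over `ℕ` with **non-negative** coefficients: locally
`∏_{i < f g} det(1 - A ⊗ ξⁱ Ā x)⁻¹ = det(1 - A^f ⊗ Ā^f x^f)^{-g}`
(`prod_range_eval_satakePairPolynomial_map_mul`) `= exp (∑_{f ∣ k} l |p_k(α)|² x^k / k)`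
(`hasSum_ite_dvd_normSq_powerSum_mul_pow_div`), and one sums over `v` and exponentiates as in
`partialPairL_conjFamily_eq_exp_LSeries`. [folklore] -/
theorem prod_partialPairL_twists_conj_eq_exp_LSeries {S : Set (HeightOneSpectrum (𝓞 K))}
    {α : SatakeFamily K} {n : ℕ}
    (hb : ∀ v ∉ S, ∀ a ∈ α v, ‖a‖ ≤ Real.sqrt v.residueCard)
    (hcard : ∀ v ∉ S, Multiset.card (α v) ≤ n) {l : ℕ} (hl : 0 < l)
    (f g : HeightOneSpectrum (𝓞 K) → ℕ) (ξ : HeightOneSpectrum (𝓞 K) → ℂ)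
    (hfg : ∀ v ∉ S, f v * g v = l) (hξ : ∀ v ∉ S, IsPrimitiveRoot (ξ v) (f v))
    {s : ℂ} (hs : 2 < s.re)
    (hmul : ∀ i ∈ Finset.range l, Multipliable fun v : {v : HeightOneSpectrum (𝓞 K) // v ∉ S} =>
      ((satakePairPolynomial (α v.1) (((α v.1).map conj).map (ξ v.1 ^ i * ·))).eval
        ((v.1.residueCard : ℂ) ^ (-s)))⁻¹) :
    ∏ i ∈ Finset.range l, partialPairL S α (fun v => ((α v).map conj).map (ξ v ^ i * ·)) s =
      cexp (LSeries (fiberCoeff (fun i : ℕ × {v : HeightOneSpectrum (𝓞 K) // v ∉ S} =>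
        if f i.2.1 ∣ i.1 + 1 then (l : ℝ) * jsCoeff S α i else 0) (jsBase S)) s) := by
  classical
  set c : ℕ × {v : HeightOneSpectrum (𝓞 K) // v ∉ S} → ℝ := fun i =>
    if f i.2.1 ∣ i.1 + 1 then (l : ℝ) * jsCoeff S α i else 0 with hc
  have hfv : ∀ v ∉ S, 0 < f v := fun v hv => Nat.pos_of_ne_zero fun h0 => by
    have := hfg v hv
    rw [h0, zero_mul] at this
    omega
  -- the coefficient family is non-negative and dominated by `l · jsCoeff`
  have hc0 : 0 ≤ c := fun i => by
    simp only [hc, Pi.zero_apply]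
    split_ifs
    · exact mul_nonneg (Nat.cast_nonneg _) (jsCoeff_nonneg S α i)
    · exact le_rfl
  have hcle : ∀ i, c i ≤ l * jsCoeff S α i := fun i => by
    simp only [hc]
    split_ifs
    · exact le_rfl
    · exact mul_nonneg (Nat.cast_nonneg _) (jsCoeff_nonneg S α i)
  have hsumR : Summable fun i => c i * (jsBase S i : ℝ) ^ (-s.re) :=
    (((summable_jsCoeff_mul_rpow_neg_of_sqrt hb hcard hs).mul_left (l : ℝ)).of_nonneg_of_le
      (fun i => mul_nonneg (hc0 i) (Real.rpow_nonneg (Nat.cast_nonneg _) _))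
      (fun i => by
        rw [← mul_assoc]
        exact mul_le_mul_of_nonneg_right (hcle i) (Real.rpow_nonneg (Nat.cast_nonneg _) _)))
  have hsumC : Summable fun i => (c i : ℂ) * (jsBase S i : ℂ) ^ (-s) :=
    summable_ofReal_mul_natCast_cpow hc0 (jsBase_ne_zero S) hsumR
  have hL : HasSum (fun i => (c i : ℂ) * (jsBase S i : ℂ) ^ (-s))
      (LSeries (fiberCoeff c (jsBase S)) s) := by
    rw [LSeries_fiberCoeff_eq (jsBase_ne_zero S) hsumC]
    exact hsumC.hasSum
  -- sum first over `k`, for each `v ∉ S`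
  set G : {v : HeightOneSpectrum (𝓞 K) // v ∉ S} → ℂ := fun v =>
    (g v.1 : ℂ) * -((satakeTensor ((α v.1).map (· ^ f v.1)) (((α v.1).map (· ^ f v.1)).map conj)).map
      fun c => Complex.log (1 - c * ((v.1.residueCard : ℂ) ^ (-s)) ^ f v.1)).sum with hG
  have hx : ∀ v : {v : HeightOneSpectrum (𝓞 K) // v ∉ S},
      Real.sqrt v.1.residueCard * Real.sqrt v.1.residueCard * ‖(v.1.residueCard : ℂ) ^ (-s)‖ < 1 := by
    intro v
    have hq1 : (1 : ℝ) < v.1.residueCard := by exact_mod_cast v.1.one_lt_residueCard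
    have hq0 : (0 : ℝ) < v.1.residueCard := zero_lt_one.trans hq1
    rw [Real.mul_self_sqrt hq0.le, norm_natCast_cpow_of_pos (zero_lt_one.trans
      v.1.one_lt_residueCard), neg_re]
    calc (v.1.residueCard : ℝ) * (v.1.residueCard : ℝ) ^ (-s.re)
          = (v.1.residueCard : ℝ) ^ (1 + -s.re) := by rw [Real.rpow_add hq0, Real.rpow_one]
      _ < 1 := Real.rpow_lt_one_of_one_lt_of_neg hq1 (by linarith)
  have hfib : ∀ v : {v : HeightOneSpectrum (𝓞 K) // v ∉ S},
      HasSum (fun k : ℕ => (c (k, v) : ℂ) * (jsBase S (k, v) : ℂ) ^ (-s)) (G v) := by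
    intro v
    have h := hasSum_ite_dvd_normSq_powerSum_mul_pow_div (Real.sqrt_nonneg _) (hb v.1 v.2) (hx v)
      (hfv v.1 v.2) (g v.1) l (hfg v.1 v.2)
    refine h.congr_fun fun k => ?_
    simp only [hc]
    split_ifs with hdvd
    · rw [Complex.ofReal_mul, Complex.ofReal_natCast, mul_assoc, jsCoeff_mul_cpow_neg]
    · rw [Complex.ofReal_zero, zero_mul]
  have hGsum : HasSum G (LSeries (fiberCoeff c (jsBase S)) s) :=
    HasSum.prod_fiberwise
      ((Equiv.prodComm {v : HeightOneSpectrum (𝓞 K) // v ∉ S} ℕ).hasSum_iff.mpr hL) hfib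
  -- exponentiate
  have hP := hGsum.cexp
  have hfun : (cexp ∘ G) = fun v : {v : HeightOneSpectrum (𝓞 K) // v ∉ S} =>
      (((satakePairPolynomial ((α v.1).map (· ^ f v.1)) (((α v.1).map (· ^ f v.1)).map conj)).eval
        (((v.1.residueCard : ℂ) ^ (-s)) ^ f v.1)) ^ g v.1)⁻¹ := by
    funext v
    simp only [Function.comp_apply, hG]
    exact cexp_natCast_mul_neg_sum_log_eq (Real.sqrt_nonneg _) (hb v.1 v.2) (hx v) (hfv v.1 v.2) _
  rw [hfun] at hP
  -- the product side, place by place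
  have key : ∏ i ∈ Finset.range l, partialPairL S α (fun v => ((α v).map conj).map (ξ v ^ i * ·)) s =
      ∏' v : {v : HeightOneSpectrum (𝓞 K) // v ∉ S},
        (((satakePairPolynomial ((α v.1).map (· ^ f v.1)) (((α v.1).map (· ^ f v.1)).map conj)).eval
          (((v.1.residueCard : ℂ) ^ (-s)) ^ f v.1)) ^ g v.1)⁻¹ := by
    have h1 : ∏ i ∈ Finset.range l, partialPairL S α (fun v => ((α v).map conj).map (ξ v ^ i * ·)) s =
        ∏' v : {v : HeightOneSpectrum (𝓞 K) // v ∉ S}, ∏ i ∈ Finset.range l,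
          ((satakePairPolynomial (α v.1) (((α v.1).map conj).map (ξ v.1 ^ i * ·))).eval
            ((v.1.residueCard : ℂ) ^ (-s)))⁻¹ := by
      rw [Multipliable.tprod_finsetProd hmul]
      simp only [partialPairL]
    rw [h1]
    refine tprod_congr fun v => ?_
    have hconj : ((α v.1).map conj).map (· ^ f v.1) = ((α v.1).map (· ^ f v.1)).map conj := by
      rw [Multiset.map_map, Multiset.map_map]
      exact Multiset.map_congr rfl fun a _ => by simp only [Function.comp_apply, map_pow]
    rw [← hfg v.1 v.2, Finset.prod_inv_distrib,
      prod_range_eval_satakePairPolynomial_map_mul (hξ v.1 v.2) (hfv v.1 v.2) (g v.1), hconj]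
  rw [key]
  exact hP.tprod_eq

end Global

/-! ### The contradiction at one place: such an exponential is not holomorphic on `Re s > A`, `A < 0` -/

section Core

variable {K : Type} [Field K] [NumberField K]

/-- **Cyclic positivity at a single place contradicts holomorphy to the left of `Re s = 0`.** Let
`α` be a Satake family with `|a| ≤ q_v^{1/2}` and `≤ n` entries off `S`, and `c ≥ 0` a family of
coefficients on `ℕ × {v ∉ S}` dominated by `l · |p_{k+1}(α_v)|²/(k+1)` and *equal* to it at one
place `v₀ ∉ S` along the exponents `k + 1` divisible by some `f₀ ≥ 1`, where `α_{v₀}` has `N ≥ 1`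
entries with `|∏ α_{v₀}| = 1`. Then no function `F` holomorphic on `{Re s > A}`, **`A < 0`**, agrees
with `exp (∑_m b_m m^{-s})`, `b = fiberCoeff c (q_v^{k+1})`, on a right half-plane. Indeed `b ≥ 0`
has abscissa `≤ 2` (`summable_jsCoeff_mul_rpow_neg_of_sqrt`), so by Landau's lemma
(`Landau.abscissaOfAbsConv_le_of_exp_eq`) the abscissa is `≤ A` and the family converges at
`σ = A/2 < 0`; in particular `l |p_m(α_{v₀})|² q_{v₀}^{m|σ|} / m → 0` along `f₀ ∣ m`. But for every
`j` the multiset `α_{v₀}^{f₀ j}` has `|∏| = 1`, so some `k ≤ N` has `|p_{f₀ j k}(α_{v₀})| ≥ 2^{-(N+1)}`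
(`exists_norm_powerSum_ge_of_norm_prod_eq_one`), and `q^{m|σ|} ≥ m` for `m` large: the terms are
`≥ l 4^{-(N+1)}` infinitely often. [folklore] -/
theorem false_of_differentiableOn_eq_cexp_LSeries_fiberCoeff {S : Set (HeightOneSpectrum (𝓞 K))}
    {α : SatakeFamily K} {n : ℕ}
    (hb : ∀ v ∉ S, ∀ a ∈ α v, ‖a‖ ≤ Real.sqrt v.residueCard)
    (hcard : ∀ v ∉ S, Multiset.card (α v) ≤ n)
    {c : ℕ × {v : HeightOneSpectrum (𝓞 K) // v ∉ S} → ℝ} (hc0 : 0 ≤ c) {l : ℕ} (hl : 0 < l)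
    (hcle : ∀ i, c i ≤ l * jsCoeff S α i)
    {v₀ : HeightOneSpectrum (𝓞 K)} (hv₀ : v₀ ∉ S) {f₀ : ℕ} (hf₀ : 0 < f₀)
    (hN : 1 ≤ Multiset.card (α v₀)) (hprod : ‖(α v₀).prod‖ = 1)
    (hcv₀ : ∀ k : ℕ, f₀ ∣ k + 1 → c (k, ⟨v₀, hv₀⟩) = l * jsCoeff S α (k, ⟨v₀, hv₀⟩))
    {A x₀ : ℝ} (hA : A < 0) {F : ℂ → ℂ} (hF : DifferentiableOn ℂ F {s : ℂ | A < s.re})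
    (hFeq : ∀ s : ℂ, x₀ < s.re → F s = cexp (LSeries (fiberCoeff c (jsBase S)) s)) : False := by
  -- the abscissa of `b` is `≤ 2`
  have hsum2 : ∀ σ : ℝ, 2 < σ → Summable fun i => c i * (jsBase S i : ℝ) ^ (-σ) := fun σ hσ =>
    (((summable_jsCoeff_mul_rpow_neg_of_sqrt hb hcard hσ).mul_left (l : ℝ)).of_nonneg_of_le
      (fun i => mul_nonneg (hc0 i) (Real.rpow_nonneg (Nat.cast_nonneg _) _))
      (fun i => by
        rw [← mul_assoc]
        exact mul_le_mul_of_nonneg_right (hcle i) (Real.rpow_nonneg (Nat.cast_nonneg _) _)))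
  have hax : LSeries.abscissaOfAbsConv (fiberCoeff c (jsBase S)) ≤ (max x₀ 2 : ℝ) := by
    refine (LSeries.abscissaOfAbsConv_le_of_forall_lt_LSeriesSummable fun y hy => ?_).trans
      (by exact_mod_cast le_max_right x₀ 2)
    exact (summable_mul_rpow_neg_iff hc0 (jsBase_ne_zero S) (finite_fiber_jsBase S) y).mp
      (hsum2 y hy)
  -- Landau: the abscissa is `≤ A`, so the family converges at `σ = A / 2 < 0`
  have hA' : LSeries.abscissaOfAbsConv (fiberCoeff c (jsBase S)) ≤ A :=
    Literature.NumberTheory.LFunctions.Landau.abscissaOfAbsConv_le_of_exp_eq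
      (fiberCoeff_nonneg hc0 _) hax hF fun s hs => hFeq s ((le_max_left _ _).trans_lt hs)
  set σ : ℝ := A / 2 with hσ
  have hσA : A < σ := by rw [hσ]; linarith
  have hσ0 : σ < 0 := by rw [hσ]; linarith
  have hsumσ : Summable fun i => c i * (jsBase S i : ℝ) ^ (-σ) := by
    refine (summable_mul_rpow_neg_iff hc0 (jsBase_ne_zero S) (finite_fiber_jsBase S) σ).mpr
      (LSeriesSummable_of_abscissaOfAbsConv_lt_re ?_)
    rw [Complex.ofReal_re]
    exact hA'.trans_lt (by exact_mod_cast hσA)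
  -- restrict to the place `v₀`
  have hinj : Function.Injective fun k : ℕ => ((k, ⟨v₀, hv₀⟩) : ℕ × {v : HeightOneSpectrum (𝓞 K) // v ∉ S}) :=
    fun a b h => (Prod.ext_iff.mp h).1
  have h1 := hsumσ.comp_injective hinj
  have h0 := h1.tendsto_cofinite_zero
  rw [Nat.cofinite_eq_atTop] at h0
  -- constants
  set N : ℕ := Multiset.card (α v₀) with hNdef
  set C : ℝ := 1 / 2 ^ (N + 1) with hC
  have hC0 : 0 < C := by positivity
  set q : ℝ := (v₀.residueCard : ℝ) with hq
  have hq1 : 1 < q := by rw [hq]; exact_mod_cast v₀.one_lt_residueCard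
  have hq0 : 0 < q := zero_lt_one.trans hq1
  set r : ℝ := q ^ (-σ) with hr
  have hr1 : 1 < r := Real.one_lt_rpow hq1 (by linarith)
  -- eventually `m ≤ r^m`
  obtain ⟨M₁, hM₁⟩ : ∃ M₁ : ℕ, ∀ m ≥ M₁, (m : ℝ) ≤ r ^ m := by
    have ht := tendsto_pow_const_div_const_pow_of_one_lt 1 hr1
    have hev := ht.eventually (gt_mem_nhds zero_lt_one)
    obtain ⟨M₁, hM₁⟩ := Filter.eventually_atTop.mp hev
    refine ⟨M₁, fun m hm => ?_⟩
    have h := hM₁ m hm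
    rw [pow_one, div_lt_one (pow_pos (zero_lt_one.trans hr1) m)] at h
    exact h.le
  -- eventually the terms at `v₀` are `< l C²`
  have hε : 0 < (l : ℝ) * C ^ 2 := by positivity
  obtain ⟨M₂, hM₂⟩ := Filter.eventually_atTop.mp (h0.eventually (gt_mem_nhds hε))
  -- the power trick at the exponent `f₀ (j + 1)`, `j = max M₁ M₂`
  set j : ℕ := max M₁ M₂ with hj
  set γ : Multiset ℂ := (α v₀).map (· ^ (f₀ * (j + 1))) with hγ
  have hγcard : Multiset.card γ = N := by rw [hγ, Multiset.card_map]
  have hγprod : ‖γ.prod‖ = 1 := by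
    rw [hγ, Multiset.prod_map_pow, Multiset.map_id', norm_pow, hprod, one_pow]
  obtain ⟨k, hk1, hkN, hkC⟩ := exists_norm_powerSum_ge_of_norm_prod_eq_one γ (hγcard ▸ hN) hγprod
  rw [hγcard] at hkN hkC
  set m : ℕ := f₀ * (j + 1) * k with hm
  have hpm : (γ.map (· ^ k)).sum = ((α v₀).map (· ^ m)).sum := by
    rw [hγ, Multiset.map_map]
    exact congrArg Multiset.sum (Multiset.map_congr rfl fun a _ => by
      simp only [Function.comp_apply, hm, pow_mul])
  rw [hpm] at hkC
  have hm1 : j + 1 ≤ m := by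
    rw [hm]
    calc j + 1 = 1 * (j + 1) * 1 := by ring
      _ ≤ f₀ * (j + 1) * k := Nat.mul_le_mul (Nat.mul_le_mul_right _ hf₀) hk1
  have hm0 : 1 ≤ m := le_trans (Nat.le_add_left 1 j) hm1
  have hdvd : f₀ ∣ (m - 1) + 1 := by
    rw [Nat.sub_add_cancel hm0, hm, mul_assoc]
    exact dvd_mul_right f₀ _
  -- the term at index `m - 1` is `≥ l C²` …
  have hterm : (l : ℝ) * C ^ 2 ≤ c (m - 1, ⟨v₀, hv₀⟩) * (jsBase S (m - 1, ⟨v₀, hv₀⟩) : ℝ) ^ (-σ) := by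
    rw [hcv₀ _ hdvd, mul_assoc, jsCoeff_mul_rpow_neg]
    have hcast : ((m - 1 : ℕ) : ℝ) + 1 = m := by
      have : ((m - 1 + 1 : ℕ) : ℝ) = (m : ℝ) := by rw [Nat.sub_add_cancel hm0]
      push_cast at this
      linarith
    simp only [Nat.sub_add_cancel hm0, hcast]
    refine mul_le_mul_of_nonneg_left ?_ (Nat.cast_nonneg l)
    -- `C² ≤ |p_m|² / (m q^{m σ})`: `|p_m| ≥ C` and `m q^{mσ} = m / r^m ≤ 1`
    have hden : (m : ℝ) * q ^ ((m : ℝ) * σ) ≤ 1 := by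
      have hrm : q ^ ((m : ℝ) * σ) = (r ^ m)⁻¹ := by
        rw [hr, ← Real.rpow_natCast (q ^ (-σ)) m, ← Real.rpow_mul hq0.le, ← Real.rpow_neg hq0.le]
        congr 1
        ring
      rw [hrm, mul_inv_le_iff₀ (pow_pos (zero_lt_one.trans hr1) m), one_mul]
      exact hM₁ m ((le_max_left M₁ M₂).trans ((Nat.le_succ j).trans hm1))
    have hden0 : 0 < (m : ℝ) * q ^ ((m : ℝ) * σ) := by
      have : (0 : ℝ) < m := by exact_mod_cast hm0
      positivity
    calc C ^ 2 = C ^ 2 / 1 := (div_one _).symm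
      _ ≤ ‖((α v₀).map (· ^ m)).sum‖ ^ 2 / ((m : ℝ) * q ^ ((m : ℝ) * σ)) :=
          div_le_div₀ (by positivity) (pow_le_pow_left₀ hC0.le hkC 2) hden0 hden
  -- … but `m - 1 ≥ M₂`, where the terms are `< l C²`
  have hlt := hM₂ (m - 1) ((le_max_right M₁ M₂).trans (Nat.le_sub_one_of_lt hm1))
  exact absurd hterm (not_le.mpr hlt)

end Core

/-! ### The pole count of the proof of Thm. 3.1, replaced: continuation for `π' ≇ σ̃ᵢ` suffices -/

section Poles

variable {n : ℕ} {K : Type} [Field K] [NumberField K] {μ : Measure (gl n K).automorphicQuotient}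
  [(gl n K).IsAutomorphicMeasure μ]

/-- **The pole count of Arthur–Clozel's proof of Thm. 3.1 without (2.2)/(2.3).** Let `π'` be
cuspidal on `GL_n(𝔸_K)` (`n ≥ 1`, multiplicity one on `L²_cusp(GL_n)`) with Satake family `α'` off
the finite `S`, and `σ₀, …, σ_{l-1}` cuspidal with Satake families `βᵢ`. Suppose the product
`∏_{i<l} L^S(s, π' × σᵢ)` agrees on a right half-plane with `exp (∑_m b_m m^{-s})` for a regrouped
family `b = fiberCoeff c (q_v^{k+1})`, `c ≥ 0`, of the cyclic shape of
`false_of_differentiableOn_eq_cexp_LSeries_fiberCoeff` (dominated by `l' |p_{k+1}(α_v)|²/(k+1)` for a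
family `α` with the local bound, and equal to it at one place `v₀ ∉ S` along `f₀ ∣ k + 1`, where
`|∏ α_{v₀}| = 1`). If for cuspidal pairs `π ≇ σ̃` on `GL_n × GL_n` the partial `L`-function
`L^S(s, π × σ)` agrees on `Re s > 1` with a function holomorphic on `{Re s > A}` for some **`A < 0`**
(`h₁`; e.g. Mœglin–Waldspurger's Corollaire (i)(b)), then `π' = σ̄ᵢ` for some `i < l`: otherwise
the product of the `l` continuations is holomorphic on `{Re s > A}` and equals `exp (LSeries b s)`
far to the right, which the previous theorem forbids.
[cite: ArthurClozelAMS120, Ch. 3, proof of Thm. 3.1 (p. 172)] -/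
theorem exists_eq_conj_of_prod_partialPairL_eq_cexp_LSeries {A : ℝ} (hA : A < 0) (hn : 0 < n)
    (hm : multiplicity_one_gl n K μ)
    (h₁ : ∀ (_hn : 0 < n) (_h₁ : multiplicity_one_gl n K μ) (P P' : CuspidalAutomorphicRepGL n K μ)
      (_hne : P ≠ P'.conj) {S : Set (HeightOneSpectrum (𝓞 K))} (_hS : S.Finite)
      {α β : SatakeFamily K} (_hα : IsSatakeFamilyOf P S α) (_hβ : IsSatakeFamilyOf P' S β),
      ∃ E : ℂ → ℂ, DifferentiableOn ℂ E {s : ℂ | A < s.re} ∧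
        ∀ s : ℂ, 1 < s.re → E s = partialPairL S α β s)
    (P' : CuspidalAutomorphicRepGL n K μ) {S : Set (HeightOneSpectrum (𝓞 K))} (hS : S.Finite)
    {α' : SatakeFamily K} (hα' : IsSatakeFamilyOf P' S α')
    {l : ℕ} (Q : ℕ → CuspidalAutomorphicRepGL n K μ) (β : ℕ → SatakeFamily K)
    (hβ : ∀ i ∈ Finset.range l, IsSatakeFamilyOf (Q i) S (β i))
    {α : SatakeFamily K} {N : ℕ}
    (hb : ∀ v ∉ S, ∀ a ∈ α v, ‖a‖ ≤ Real.sqrt v.residueCard)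
    (hcard : ∀ v ∉ S, Multiset.card (α v) ≤ N)
    {c : ℕ × {v : HeightOneSpectrum (𝓞 K) // v ∉ S} → ℝ} (hc0 : 0 ≤ c) {l' : ℕ} (hl' : 0 < l')
    (hcle : ∀ i, c i ≤ l' * jsCoeff S α i)
    {v₀ : HeightOneSpectrum (𝓞 K)} (hv₀ : v₀ ∉ S) {f₀ : ℕ} (hf₀ : 0 < f₀)
    (hN : 1 ≤ Multiset.card (α v₀)) (hprod : ‖(α v₀).prod‖ = 1)
    (hcv₀ : ∀ k : ℕ, f₀ ∣ k + 1 → c (k, ⟨v₀, hv₀⟩) = l' * jsCoeff S α (k, ⟨v₀, hv₀⟩))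
    {x₀ : ℝ} (heq : ∀ s : ℂ, x₀ < s.re →
      ∏ i ∈ Finset.range l, partialPairL S α' (β i) s = cexp (LSeries (fiberCoeff c (jsBase S)) s)) :
    ∃ i ∈ Finset.range l, P' = (Q i).conj := by
  classical
  by_contra hne
  push Not at hne
  have hE : ∀ i ∈ Finset.range l, ∃ E : ℂ → ℂ, DifferentiableOn ℂ E {s : ℂ | A < s.re} ∧
      ∀ s : ℂ, 1 < s.re → E s = partialPairL S α' (β i) s :=
    fun i hi => h₁ hn hm P' (Q i) (hne i hi) hS hα' (hβ i hi)
  choose! E hEd hEeq using hE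
  refine false_of_differentiableOn_eq_cexp_LSeries_fiberCoeff hb hcard hc0 hl' hcle hv₀ hf₀ hN hprod
    hcv₀ hA (x₀ := max x₀ 1) (F := fun s => ∏ i ∈ Finset.range l, E i s)
    (DifferentiableOn.fun_finsetProd fun i hi => hEd i hi) fun s hs => ?_
  have hs1 : 1 < s.re := (le_max_right _ _).trans_lt hs
  rw [← heq s ((le_max_left _ _).trans_lt hs)]
  exact Finset.prod_congr rfl fun i hi => hEeq i hi s hs1

end Poles

/-! ### Thm. 3.1 from the continuation of `L^S(s, π × σ)`, `π ≇ σ̃`, to a half-plane `Re s > A`, `A < 0` -/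

section Reduction

variable {n : ℕ} {F E : Type} [Field F] [NumberField F] [Field E] [NumberField E] [Algebra F E]
  [FiniteDimensional F E]

/-- **Arthur–Clozel, Ch. 3, Thm. 3.1 from the holomorphy of `L^S(s, π × σ)` (`π ≇ σ̃`) on a right
half-plane `{Re s > A}`, `A < 0`, alone.** The named fact `ArthurClozel1989_fibres_of_baseChange n F E`
(`E/F` cyclic of any degree; `π`, `π'` cuspidal on `GL_n(𝔸_F)` with `(t_{π,v})^{f_v} = (t_{π',v})^{f_v}`
for almost all `v` ⟹ `π' = π ⊗ χ`, `χ` trivial on `F^* N(𝔸_E^*)`) follows from: for all cuspidal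
`π ≇ σ̃` on `GL_n(𝔸_F) × GL_n(𝔸_F)` (multiplicity one granted) and honest Satake families off a
finite `S`, `L^S(s, π × σ)` agrees on `Re s > 1` with a function holomorphic on `{Re s > A}`
(hypothesis `h₁`, the right-half-plane part of Mœglin–Waldspurger's Corollaire (i)(b)). Neither
(2.3) nor Corollaire (ii) (the pair `π ≅ σ̃`), nor the non-vanishing on `Re s = 1`, is used. Proof:
the set-up of the printed proof (p. 172) as in `arthurClozel1989_fibres_of_baseChange_of_jacquetShalika`
— the class-field character `η` (`exists_isClassFieldCharacter_holds`), `ζ_v = η(ϖ_v)` a primitive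
`f_v`-th root of unity off a finite `S`
(`IsClassFieldCharacter.eventually_isPrimitiveRoot_valueAtUniformizer_of_isCyclic`), the Euler
identity `∏_{i<l} L^S(s, π' × σᵢ) = ∏_{i<l} L^S(s, π × σᵢ)` for `σᵢ = \overline{π ⊗ ηⁱ}` on `Re s > 1`
(`prod_partialPairL_twists_eq_of_map_pow_eq`, convergence by (2.1),
`JacquetShalika1981_multipliable_partialPairL_holds`) — and then, in place of the pole count by
(2.2)/(2.3): the right-hand side is `exp` of a Dirichlet series with non-negative coefficients
(`prod_partialPairL_twists_conj_eq_exp_LSeries`: only the exponents divisible by `f_v` survive the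
sum over the `l` twists), `|∏ t_{π,v}| = |ω_π(ϖ_v)| = 1` (`CuspidalAutomorphicRepGL.exists_centralCharacter`),
so `exists_eq_conj_of_prod_partialPairL_eq_cexp_LSeries` (Landau's lemma at one unramified place)
gives `π' = σ̄ᵢ = π ⊗ ηⁱ` for some `i`, and `χ = ηⁱ` is trivial on the norm group.
[cite: ArthurClozelAMS120, Ch. 3, Thm. 3.1 and its proof (p. 172; printed volume p. 201)]
[cite: MoeglinWaldspurger1989, Appendice, Corollaire (i)(b), p. 667] -/
theorem arthurClozel1989_fibres_of_baseChange_of_ne_conj_halfPlane {A : ℝ} (hA : A < 0)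
    (h₁ : ∀ (μ : Measure (gl n F).automorphicQuotient) [(gl n F).IsAutomorphicMeasure μ]
      (_hn : 0 < n) (_h₁ : multiplicity_one_gl n F μ) (P P' : CuspidalAutomorphicRepGL n F μ)
      (_hne : P ≠ P'.conj) {S : Set (HeightOneSpectrum (𝓞 F))} (_hS : S.Finite)
      {α β : SatakeFamily F} (_hα : IsSatakeFamilyOf P S α) (_hβ : IsSatakeFamilyOf P' S β),
      ∃ L : ℂ → ℂ, DifferentiableOn ℂ L {s : ℂ | A < s.re} ∧
        ∀ s : ℂ, 1 < s.re → L s = partialPairL S α β s) :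
    ArthurClozel1989_fibres_of_baseChange n F E := by
  intro _ _ μ _ hm P P' 𝔫 𝔫' h h₀ h₀'
  classical
  rcases Nat.eq_zero_or_pos n with hn0 | hn
  · -- the degenerate rank `n = 0`
    subst hn0
    haveI := CuspidalAutomorphicRepGL.subsingleton_zero (K := F) (μ := μ)
    refine ⟨1, HeckeCharacter.isTrivialOnNormGroup_one, ?_⟩
    rw [CuspidalAutomorphicRepGL.twistByFiniteOrderChar_one]
    exact Subsingleton.elim _ _
  -- the class-field character `η` and its level `𝔪`
  obtain ⟨η, hη, -⟩ := exists_isClassFieldCharacter_holds (F := F) (E := E)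
  have hηu : η.IsUnitary := hη.isUnitary
  have hηfin : η.IsFiniteOrder := hη.isFiniteOrder
  have hηi0 : ∀ (i : ℕ) (t : NNRealˣ), (η ^ i) (posRealIdele F t) = 1 := fun i t => by
    rw [HeckeCharacter.pow_apply, HeckeCharacter.map_posRealIdele_of_isFiniteOrder hηfin t, one_pow]
  obtain ⟨𝔪, h𝔪, hη𝔪⟩ := HeckeCharacter.exists_level_of_isFiniteOrder n hηfin
  have hη𝔪i : ∀ (i : ℕ), ∀ k ∈ principalCongruenceLevel n F 𝔪,
      (η ^ i) (Matrix.GeneralLinearGroup.det k) = 1 := fun i k hk => by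
    rw [HeckeCharacter.pow_apply, hη𝔪 k hk, one_pow]
  -- Satake families of `π`, `π'`
  obtain ⟨S₁, α, -, hα⟩ := exists_isSatakeFamilyOf_holds (μ := μ) P
  obtain ⟨S₂, α', -, hα'⟩ := exists_isSatakeFamilyOf_holds (μ := μ) P'
  -- the levels of the hypothesis may be taken non-zero
  obtain ⟨𝔫₀, h𝔫₀, h𝔫₀eq⟩ := exists_ne_zero_principalCongruenceLevel_eq (n := n) 𝔫
  obtain ⟨𝔫₀', h𝔫₀', h𝔫₀'eq⟩ := exists_ne_zero_principalCongruenceLevel_eq (n := n) 𝔫'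
  rw [h𝔫₀eq] at h h₀
  rw [h𝔫₀'eq] at h h₀'
  -- the finitely many bad places
  have hunr : ∀ᶠ v : HeightOneSpectrum (𝓞 F) in cofinite, v.asIdeal.ramificationIdxIn (𝓞 E) = 1 :=
    (Filter.eventually_cofinite.2
      (GaloisRepresentations.finite_setOf_not_isUnramifiedIn F E)).mono
      fun v hv => GaloisRepresentations.ramificationIdxIn_eq_one_of_isUnramifiedIn hv
  have h𝔪' : ∀ᶠ v : HeightOneSpectrum (𝓞 F) in cofinite, ¬ v.asIdeal ∣ 𝔪 := by
    rw [Filter.eventually_cofinite]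
    simpa only [not_not] using Ideal.finite_factors h𝔪
  have h𝔫₀'' : ∀ᶠ v : HeightOneSpectrum (𝓞 F) in cofinite, ¬ v.asIdeal ∣ 𝔫₀' := by
    rw [Filter.eventually_cofinite]
    simpa only [not_not] using Ideal.finite_factors h𝔫₀'
  have hS₁ : ∀ᶠ v : HeightOneSpectrum (𝓞 F) in cofinite, v ∉ (S₁ : Set (HeightOneSpectrum (𝓞 F))) :=
    S₁.finite_toSet.compl_mem_cofinite
  have hS₂ : ∀ᶠ v : HeightOneSpectrum (𝓞 F) in cofinite, v ∉ (S₂ : Set (HeightOneSpectrum (𝓞 F))) :=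
    S₂.finite_toSet.compl_mem_cofinite
  have hαP := hα.eventually_eq_of_hasSatakeParameterAt (𝔫 := 𝔫₀) h𝔫₀
  have hα'P' := hα'.eventually_eq_of_hasSatakeParameterAt (𝔫 := 𝔫₀') h𝔫₀'
  have hgood : ∀ᶠ v : HeightOneSpectrum (𝓞 F) in cofinite,
      v ∉ (S₁ : Set (HeightOneSpectrum (𝓞 F))) ∧ v ∉ (S₂ : Set (HeightOneSpectrum (𝓞 F))) ∧
        ¬ v.asIdeal ∣ 𝔪 ∧ v.asIdeal.ramificationIdxIn (𝓞 E) = 1 ∧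
        IsPrimitiveRoot (η.valueAtUniformizer v) (v.asIdeal.inertiaDegIn (𝓞 E)) ∧
        (α' v).map (· ^ v.asIdeal.inertiaDegIn (𝓞 E)) =
          (α v).map (· ^ v.asIdeal.inertiaDegIn (𝓞 E)) := by
    filter_upwards [hS₁, hS₂, h𝔪', hunr, hη.eventually_isPrimitiveRoot_valueAtUniformizer_of_isCyclic,
      h, h₀, h₀', hαP, hα'P', h𝔫₀''] with
      v hv₁ hv₂ hv𝔪 hvunr hvprim hv h₀v h₀'v hαv hα'v hv𝔫₀'
    refine ⟨hv₁, hv₂, hv𝔪, hvunr, hvprim, ?_⟩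
    obtain ⟨ϖ, β, hβ⟩ := h₀v
    obtain ⟨ϖ', β', hβ'⟩ := h₀'v
    have hβ'' : HasSatakeParameterAt P'.1 (principalCongruenceLevel n F 𝔫₀') v ϖ β' :=
      hβ'.of_valuation_eq (isMaximalAt_principalCongruenceLevel n F v h𝔫₀' hv𝔫₀') hβ.1
    rw [hα'v ϖ β' hβ'' hv₂, hαv ϖ β hβ hv₁]
    exact hv ϖ β β' hβ hβ''
  obtain ⟨S, hSfin, hS⟩ : ∃ S : Set (HeightOneSpectrum (𝓞 F)), S.Finite ∧ ∀ v ∉ S,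
      v ∉ (S₁ : Set (HeightOneSpectrum (𝓞 F))) ∧ v ∉ (S₂ : Set (HeightOneSpectrum (𝓞 F))) ∧
        ¬ v.asIdeal ∣ 𝔪 ∧ v.asIdeal.ramificationIdxIn (𝓞 E) = 1 ∧
        IsPrimitiveRoot (η.valueAtUniformizer v) (v.asIdeal.inertiaDegIn (𝓞 E)) ∧
        (α' v).map (· ^ v.asIdeal.inertiaDegIn (𝓞 E)) =
          (α v).map (· ^ v.asIdeal.inertiaDegIn (𝓞 E)) :=
    ⟨_, Filter.eventually_cofinite.1 hgood, fun v hv => not_not.1 hv⟩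
  have hαS : IsSatakeFamilyOf P S α := hα.mono fun v hv => by_contra fun hvS => (hS v hvS).1 hv
  have hα'S : IsSatakeFamilyOf P' S α' :=
    hα'.mono fun v hv => by_contra fun hvS => (hS v hvS).2.1 hv
  -- the twists `π ⊗ ηⁱ` and their conjugates `σᵢ`, with their Satake families off `S`
  have hT : ∀ i : ℕ, IsSatakeFamilyOf (P.twistByChar (η ^ i) (hηu.pow i) (hηi0 i)) S
      fun v => (α v).map (η.valueAtUniformizer v ^ i * ·) := by
    intro i
    simpa only [HeckeCharacter.valueAtUniformizer_pow] using
      hαS.twistByChar (η ^ i) (hηu.pow i) (hηi0 i) h𝔪 (hη𝔪i i) fun v hv => (hS v hv).2.2.1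
  have hQ : ∀ i : ℕ, IsSatakeFamilyOf (P.twistByChar (η ^ i) (hηu.pow i) (hηi0 i)).conj S
      fun v => ((α v).map (starRingEnd ℂ)).map
        (starRingEnd ℂ (η.valueAtUniformizer v) ^ i * ·) := by
    intro i
    have hfun : (fun v => ((α v).map (η.valueAtUniformizer v ^ i * ·)).map (starRingEnd ℂ)) =
        fun v => ((α v).map (starRingEnd ℂ)).map
          (starRingEnd ℂ (η.valueAtUniformizer v) ^ i * ·) := by
      funext v
      rw [Multiset.map_map, Multiset.map_map]
      exact Multiset.map_congr rfl fun a _ => by simp only [Function.comp_apply, map_mul, map_pow]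
    have := (hT i).conj
    rwa [hfun] at this
  -- `f_v g_v = l`, `ζ̄_v` primitive, off `S`
  have hfg : ∀ v ∉ S, v.asIdeal.inertiaDegIn (𝓞 E) *
      Nat.card {w : HeightOneSpectrum (𝓞 E) // w.under (𝓞 F) = v} = Module.finrank F E := by
    intro v hv
    rw [mul_comm]
    exact card_placesOver_mul_inertiaDegIn v (hS v hv).2.2.2.1
  have hξ : ∀ v ∉ S, IsPrimitiveRoot (starRingEnd ℂ (η.valueAtUniformizer v))
      (v.asIdeal.inertiaDegIn (𝓞 E)) := fun v hv =>
    ((hS v hv).2.2.2.2.1).map_of_injective (starRingEnd ℂ).injective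
  -- the Euler-product identity (2.1 gives convergence)
  have heq : ∀ s : ℂ, 1 < s.re →
      ∏ i ∈ Finset.range (Module.finrank F E), partialPairL S α'
          (fun v => ((α v).map (starRingEnd ℂ)).map (starRingEnd ℂ (η.valueAtUniformizer v) ^ i * ·)) s =
        ∏ i ∈ Finset.range (Module.finrank F E), partialPairL S α
          (fun v => ((α v).map (starRingEnd ℂ)).map (starRingEnd ℂ (η.valueAtUniformizer v) ^ i * ·)) s :=
    fun s hs => prod_partialPairL_twists_eq_of_map_pow_eq S Module.finrank_pos
      (fun v => v.asIdeal.inertiaDegIn (𝓞 E))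
      (fun v => Nat.card {w : HeightOneSpectrum (𝓞 E) // w.under (𝓞 F) = v})
      (fun v => starRingEnd ℂ (η.valueAtUniformizer v)) hfg hξ
      α α' (fun v => (α v).map (starRingEnd ℂ)) (fun v hv => (hS v hv).2.2.2.2.2)
      (fun i _ => JacquetShalika1981_multipliable_partialPairL_holds P _ hαS (hQ i) hs)
      (fun i _ => JacquetShalika1981_multipliable_partialPairL_holds P' _ hα'S (hQ i) hs)
  -- the right-hand side is `exp` of a Dirichlet series with non-negative coefficients (`Re s > 2`)
  have hb : ∀ v ∉ S, ∀ a ∈ α v, ‖a‖ ≤ Real.sqrt v.residueCard := fun v hv a ha =>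
    norm_satakeParameter_le_sqrt_holds P hαS hv ha
  have hcard : ∀ v ∉ S, Multiset.card (α v) ≤ n := fun v hv => (hαS.card_eq hv).le
  have hexp : ∀ s : ℂ, 2 < s.re →
      ∏ i ∈ Finset.range (Module.finrank F E), partialPairL S α'
          (fun v => ((α v).map (starRingEnd ℂ)).map (starRingEnd ℂ (η.valueAtUniformizer v) ^ i * ·)) s =
        cexp (LSeries (fiberCoeff (fun i : ℕ × {v : HeightOneSpectrum (𝓞 F) // v ∉ S} =>
          if i.2.1.asIdeal.inertiaDegIn (𝓞 E) ∣ i.1 + 1 then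
            (Module.finrank F E : ℝ) * jsCoeff S α i else 0) (jsBase S)) s) := by
    intro s hs
    have hs1 : 1 < s.re := by linarith
    rw [heq s hs1]
    exact prod_partialPairL_twists_conj_eq_exp_LSeries hb hcard Module.finrank_pos
      (fun v => v.asIdeal.inertiaDegIn (𝓞 E))
      (fun v => Nat.card {w : HeightOneSpectrum (𝓞 E) // w.under (𝓞 F) = v})
      (fun v => starRingEnd ℂ (η.valueAtUniformizer v)) hfg hξ hs
      (fun i _ => JacquetShalika1981_multipliable_partialPairL_holds P _ hαS (hQ i) hs1)
  -- one unramified place `v₀ ∉ S`, where `|∏ t_{π,v₀}| = |ω_π(ϖ_{v₀})| = 1`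
  obtain ⟨v₀, hv₀⟩ : ∃ v₀ : HeightOneSpectrum (𝓞 F), v₀ ∉ S := by
    by_contra! hall
    have hfin : (Set.univ : Set (HeightOneSpectrum (𝓞 F))).Finite := hSfin.subset fun v _ => hall v
    haveI : Finite (HeightOneSpectrum (𝓞 F)) := Set.finite_univ_iff.mp hfin
    exact GaloisRepresentations.not_summable_residueCard_inv (K := F) (Summable.of_finite)
  have hprod : ‖(α v₀).prod‖ = 1 := by
    obtain ⟨ω, hu, -, -, -, hfam⟩ := P.exists_centralCharacter
    rw [← (hfam hαS v₀ hv₀).2]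
    exact GaloisRepresentations.HeckeCharacter.norm_valueAtUniformizer_of_isUnitary hu v₀
  have hN : 1 ≤ Multiset.card (α v₀) := by rw [hαS.card_eq hv₀]; exact hn
  have hf₀ : 0 < v₀.asIdeal.inertiaDegIn (𝓞 E) := Nat.pos_of_ne_zero fun h0 => by
    have := hfg v₀ hv₀
    rw [h0, zero_mul] at this
    exact absurd this.symm Module.finrank_pos.ne'
  -- the pole count, replaced
  obtain ⟨i, -, hi⟩ := exists_eq_conj_of_prod_partialPairL_eq_cexp_LSeries hA hn hm (h₁ μ) P' hSfin
    hα'S (fun i => (P.twistByChar (η ^ i) (hηu.pow i) (hηi0 i)).conj)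
    (fun i v => ((α v).map (starRingEnd ℂ)).map (starRingEnd ℂ (η.valueAtUniformizer v) ^ i * ·))
    (fun i _ => hQ i) hb hcard
    (c := fun i : ℕ × {v : HeightOneSpectrum (𝓞 F) // v ∉ S} =>
      if i.2.1.asIdeal.inertiaDegIn (𝓞 E) ∣ i.1 + 1 then (Module.finrank F E : ℝ) * jsCoeff S α i else 0)
    (fun i => by
      simp only [Pi.zero_apply]
      split_ifs
      · exact mul_nonneg (Nat.cast_nonneg _) (jsCoeff_nonneg S α i)
      · exact le_rfl)
    Module.finrank_pos
    (fun i => by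
      show (if i.2.1.asIdeal.inertiaDegIn (𝓞 E) ∣ i.1 + 1 then
        (Module.finrank F E : ℝ) * jsCoeff S α i else 0) ≤ _
      split_ifs
      · exact le_rfl
      · exact mul_nonneg (Nat.cast_nonneg _) (jsCoeff_nonneg S α i))
    hv₀ hf₀ hN hprod (fun k hk => if_pos hk) hexp
  refine ⟨η ^ i, hη.pow_isTrivialOnNormGroup i, ?_⟩
  simp only [CuspidalAutomorphicRepGL.conj_conj] at hi
  exact hi

/-- **Arthur–Clozel, Ch. 3, Thm. 3.1, conditional only on Mœglin–Waldspurger's Corollaire (i)(b).**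
The named fact `ArthurClozel1989_fibres_of_baseChange n F E` follows from the single continuation
statement `MoeglinWaldspurger1989_partialPairL_entire_of_ne_conj` (for cuspidal `π ≇ σ̃` on
`GL_n × GL_n` over `F`, `L^S(s, π × σ)` extends to an entire function; Mœglin–Waldspurger (1989),
Appendice, Corollaire (i)(b), p. 667) — the previous theorem with `A = -1`. Compared with
`arthurClozel1989_fibres_of_baseChange_of_moeglinWaldspurger`, Corollaire (ii) (the pair `π ≅ σ̃`)
is no longer needed. [cite: ArthurClozelAMS120, Ch. 3, Thm. 3.1 (p. 172; printed volume p. 201)]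
[cite: MoeglinWaldspurger1989, Appendice, Corollaire (i)(b), p. 667] -/
theorem arthurClozel1989_fibres_of_baseChange_of_entire_of_ne_conj
    (h₁ : ∀ (μ : Measure (gl n F).automorphicQuotient) [(gl n F).IsAutomorphicMeasure μ],
      MoeglinWaldspurger1989_partialPairL_entire_of_ne_conj (n := n) (K := F) (μ := μ)) :
    ArthurClozel1989_fibres_of_baseChange n F E :=
  arthurClozel1989_fibres_of_baseChange_of_ne_conj_halfPlane (A := -1) (by norm_num)
    fun μ _ hn hm P P' hne _ hS _ _ hα hβ => by
      obtain ⟨L, hL, hLeq⟩ := h₁ μ hn hm P P' hne hS hα hβ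
      exact ⟨L, hL.differentiableOn, hLeq⟩

end Reduction

end Literature.NumberTheory.Automorphic
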